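import Summits.ResolutionOfSingularities.ResolutionOfSingularities.Theorems.DeltaCutStellarLatRound

/-!
# StellarCut L20c — «LatentCut»: the ARTIN–SCHREIER FIBRE GUARD, the latent round lemma and the drop of the latent mass
# (lens-6 «barrier-complement carving», g36; engine of the cell `WORNCHypWildLat`)

THE GUARD `supp M' ⊆ V(H')` of the latent hop (L20b) — the one new polynomial input of the line.  At a point `y` of the face
`C = V(H) ∩ V(K)` (centre parameters `c₀ = h·(unit)`, `c₁ = z_K`) the Artin–Schreier stalk `hᵖ + v(h − c m_μ) m_b m_μ^{p−1}`
times a unit is the value at `(c₀, c₁)` of the FIBRE FORM `F = X₀ᵖ + α·X₀X₁^{p−1} + αγ·X₁ᵖ ∈ 𝒪_y[X₀, X₁]_p`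
(`ncHypShapeLat.exists_fibre_data`; the cofactor `γ` absorbs `c·m_μ/z_K`, so that the two lower coefficients DEGENERATE TOGETHER:
`α ∉ 𝒪_y^× ⇒ α, αγ ∈ 𝔪_y`).  Reduced mod `𝔪_y` and dehomogenised (`p = 0` in `κ(y)`):
* `K`-chart: `Tᵖ + ᾱT + ᾱγ̄` — if `ᾱ = 0` it is `Tᵖ ∉ 𝔮` (`T ∉ 𝔮` off `V(H')`); else `∂_T = ᾱ ∈ κ^×`;
* `H`-chart: `1 + ᾱU^{p−1} + ᾱγ̄Uᵖ` — if `ᾱ = 0` it is `1`; else `∂_U = −ᾱU^{p−2}` and `U ∉ 𝔮` whenever the form is in `𝔮`;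
so the form has order `≤ 1` at every prime of every chart (`latentForm_notMem_sq`), and the near-point bound T10c
(`IsBlowup.not_stalkIdeal_controlledTransform_le_pow_of_fibre`, BY NAME) gives `𝓘'_{x'} ⊄ 𝔪_{x'}²` over the centre off `V(H')`:
NO point of order `≥ p ≥ 2` escapes `V(H')` — for EVERY residue field and with no tightness / parity hypothesis on the labels
(the Artin–Schreier linear term `ᾱ·X₀X₁^{p−1}` is what the binomial guards T12/T15/T18 never had).

* `latentForm`, `isHomogeneous_latentForm`, `latentForm_notMem_sq` — the form and its chart guard (pure commutative algebra);
* `ncHypShapeLat.exists_fibre_data` — the fibre form at a point of the face;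
* `ncHypShapeLat.not_stalkIdeal_transform_le_sq`, `ncHypShapeLat.support_transform_subset` — the guard;
* `ncHypShapeLat.transform` — ★ THE LATENT ROUND LEMMA (L20b + the guard);
* `ncHypShapeLat.latMass_transform_lt` — the latent mass DROPS under the hop.

0 sorry; axioms standard. [new] [cite: CossartPiltant2008, Prop. 4.2 (a)] [cite: Kollar2007, (3.111) Step 3]
[cite: AtiyahMacdonald1969, Cor. 3.15]
-/
noncomputable section

open CategoryTheory CategoryTheory.Limits AlgebraicGeometry TopologicalSpace IsLocalRing
open Literature.AlgebraicGeometry.Resolution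

namespace Summit.ResolutionOfSingularities.ResolutionOfSingularities.Theorems.DeltaCutClasses

open Summit.ResolutionOfSingularities.ResolutionOfSingularities.Theorems
open WeakOrderReduction ForcedTowerClasses MvPolynomial

/-! ### §Form — the Artin–Schreier fibre form and its chart guard (commutative algebra) -/

section Form

variable {R : Type*} [CommRing R]

/-- **THE ARTIN–SCHREIER FIBRE FORM** `X₀ᵖ + α·X₀·X₁^{p−1} + β·X₁ᵖ ∈ R[X₀, X₁]`. DEFINITION. [cite: CossartPiltant2008, Prop. 4.2] -/
def latentForm (p : ℕ) (α β : R) : MvPolynomial (Fin 2) R :=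
  X 0 ^ p + C α * X 0 * X 1 ^ (p - 1) + C β * X 1 ^ p

/-- the fibre form is homogeneous of degree `p` (`p ≥ 1`). [folklore] -/
theorem isHomogeneous_latentForm {p : ℕ} (hp : 1 ≤ p) (α β : R) : (latentForm p α β).IsHomogeneous p := by
  have h2 : (C α * X 0 * X 1 ^ (p - 1) : MvPolynomial (Fin 2) R).IsHomogeneous (0 + 1 + (p - 1)) :=
    ((isHomogeneous_C _ α).mul (isHomogeneous_X _ 0)).mul (isHomogeneous_X_pow _ _)
  have h3 : (C β * X 1 ^ p : MvPolynomial (Fin 2) R).IsHomogeneous (0 + p) :=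
    (isHomogeneous_C _ β).mul (isHomogeneous_X_pow _ _)
  rw [zero_add, Nat.add_sub_cancel' hp] at h2
  rw [zero_add] at h3
  exact ((isHomogeneous_X_pow 0 p).add h2).add h3

/-- `MvPolynomial.map` fixes the killed variables. [folklore] -/
theorem map_killVar {S : Type*} [CommRing S] {σ : Type*} [DecidableEq σ] (f : R →+* S) (j i : σ) :
    MvPolynomial.map f (killVar j i) = killVar j i := by
  by_cases h : i = j
  · subst h
    rw [killVar_self, killVar_self, map_one]
  · rw [killVar_of_ne j h, killVar_of_ne j h, MvPolynomial.map_X]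

/-- the range of a pair. [folklore] -/
theorem latRange_fin_two {A : Type*} (x : Fin 2 → A) : Set.range x = {x 0, x 1} := by
  ext w
  simp only [Set.mem_range, Fin.exists_fin_two, Set.mem_insert_iff, Set.mem_singleton_iff, eq_comm]

variable [IsLocalRing R]

/-- **THE ARTIN–SCHREIER CHART GUARD** (`p ≥ 2`, `p = 0` in `R`): the reduced dehomogenised fibre form
`X₀ᵖ + α X₀X₁^{p−1} + αγ X₁ᵖ` has order `≤ 1` at every prime `𝔮 ∌ X₀` of every chart.  `K`-chart: `Tᵖ + ᾱT + ᾱγ̄`, `∂_T = ᾱ`;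
`H`-chart: `1 + ᾱU^{p−1} + ᾱγ̄Uᵖ`, `∂_U = −ᾱU^{p−2}`; degenerate case `ᾱ = 0`: `Tᵖ` resp. `1`, not in `𝔮`. [new]
[cite: CossartPiltant2008, proof of Prop. 4.2 (a)] -/
theorem latentForm_notMem_sq {p : ℕ} (hp : 2 ≤ p) (hpR : ((p : ℕ) : R) = 0) (α γ : R) (j : Fin 2)
    (𝔮 : Ideal (MvPolynomial {l : Fin 2 // l ≠ j} (R ⧸ maximalIdeal R))) [𝔮.IsPrime]
    (h𝔮 : ∀ l : {l : Fin 2 // l ≠ j}, l.1 ∈ ({0} : Set (Fin 2)) →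
      (MvPolynomial.X l : MvPolynomial {l : Fin 2 // l ≠ j} (R ⧸ maximalIdeal R)) ∉ 𝔮) :
    algebraMap _ (Localization.AtPrime 𝔮) (MvPolynomial.map (Ideal.Quotient.mk (maximalIdeal R))
      (dehomogenize j (latentForm p α (α * γ)))) ∉ maximalIdeal (Localization.AtPrime 𝔮) ^ 2 := by
  classical
  obtain ⟨a, ha⟩ : ∃ a, Ideal.Quotient.mk (maximalIdeal R) α = a := ⟨_, rfl⟩
  obtain ⟨g, hg⟩ : ∃ g, Ideal.Quotient.mk (maximalIdeal R) γ = g := ⟨_, rfl⟩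
  have hp1 : 1 ≤ p := by omega
  have hpκ : ((p : ℕ) : R ⧸ maximalIdeal R) = 0 := by
    rw [← map_natCast (Ideal.Quotient.mk (maximalIdeal R)) p, hpR, map_zero]
  have hpA : ((p : ℕ) : MvPolynomial {l : Fin 2 // l ≠ j} (R ⧸ maximalIdeal R)) = 0 := by
    rw [← map_natCast (C : (R ⧸ maximalIdeal R) →+* MvPolynomial {l : Fin 2 // l ≠ j} (R ⧸ maximalIdeal R)) p, hpκ,
      map_zero]
  have hp1A : (((p - 1 : ℕ) : ℕ) : MvPolynomial {l : Fin 2 // l ≠ j} (R ⧸ maximalIdeal R)) = -1 := by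
    rw [Nat.cast_sub hp1, Nat.cast_one, hpA, zero_sub]
  have hF : MvPolynomial.map (Ideal.Quotient.mk (maximalIdeal R)) (dehomogenize j (latentForm p α (α * γ))) =
      killVar j 0 ^ p + C a * killVar j 0 * killVar j 1 ^ (p - 1) + C a * C g * killVar j 1 ^ p := by
    rw [map_dehomogenize, latentForm]
    simp only [map_add, map_mul, map_pow, MvPolynomial.map_X, MvPolynomial.map_C, dehomogenize_X, MvPolynomial.algHom_C,
      MvPolynomial.algebraMap_eq, ha, hg]
  rw [hF]
  by_cases hα : IsUnit α
  · -- the Artin–Schreier case: `ᾱ ∈ κ^×`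
    have haC : IsUnit (C a : MvPolynomial {l : Fin 2 // l ≠ j} (R ⧸ maximalIdeal R)) := by
      rw [← ha]; exact (hα.map (Ideal.Quotient.mk (maximalIdeal R))).map C
    by_cases hmem : killVar j 0 ^ p + C a * killVar j 0 * killVar j 1 ^ (p - 1) + C a * C g * killVar j 1 ^ p ∈ 𝔮
    swap
    · exact algebraMap_notMem_maximalIdeal_sq_of_notMem 𝔮 (Localization.AtPrime 𝔮) hmem
    rcases Fin.exists_fin_two.mp ⟨j, rfl⟩ with hj | hj
    · -- the `H`-chart `j = 0`: `1 + ᾱ U^{p−1} + ᾱγ̄ Uᵖ`, `U = X₁`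
      subst hj
      have h10 : (1 : Fin 2) ≠ 0 := one_ne_zero
      rw [killVar_self, killVar_of_ne 0 h10] at hmem ⊢
      -- `U ∉ 𝔮` (else `1 ∈ 𝔮`)
      have hU : (X ⟨1, h10⟩ : MvPolynomial {l : Fin 2 // l ≠ (0 : Fin 2)} (R ⧸ maximalIdeal R)) ∉ 𝔮 := by
        intro hU
        have h := 𝔮.sub_mem hmem (𝔮.add_mem (𝔮.mul_mem_left (C a * 1) (𝔮.pow_mem_of_mem hU (p - 1) (by omega)))
          (𝔮.mul_mem_left (C a * C g) (𝔮.pow_mem_of_mem hU p hp1)))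
        rw [add_assoc, add_sub_cancel_right, one_pow] at h
        exact Ideal.IsPrime.ne_top ‹_› ((Ideal.eq_top_iff_one 𝔮).mpr h)
      refine algebraMap_notMem_maximalIdeal_sq_of_derivation_apply_notMem (pderiv ⟨1, h10⟩) 𝔮 (Localization.AtPrime 𝔮)
        fun hD => hU ?_
      have hcalc : pderiv ⟨1, h10⟩ ((1 : MvPolynomial {l : Fin 2 // l ≠ (0 : Fin 2)} (R ⧸ maximalIdeal R)) ^ p +
          C a * 1 * X ⟨1, h10⟩ ^ (p - 1) + C a * C g * X ⟨1, h10⟩ ^ p) =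
            (((p - 1 : ℕ) : ℕ) : MvPolynomial {l : Fin 2 // l ≠ (0 : Fin 2)} (R ⧸ maximalIdeal R)) *
              (C a * X ⟨1, h10⟩ ^ (p - 1 - 1)) +
            ((p : ℕ) : MvPolynomial {l : Fin 2 // l ≠ (0 : Fin 2)} (R ⧸ maximalIdeal R)) *
              (C a * C g * X ⟨1, h10⟩ ^ (p - 1)) := by
        simp only [one_pow, mul_one, map_add, Derivation.leibniz, Derivation.leibniz_pow, pderiv_C, pderiv_X_self,
          add_zero, zero_add, smul_eq_mul, nsmul_eq_mul, mul_zero, Derivation.map_one_eq_zero]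
        ring
      rw [hcalc, hp1A, hpA, zero_mul, add_zero] at hD
      exact Ideal.IsPrime.mem_of_pow_mem ‹_› _
        ((Ideal.unit_mul_mem_iff_mem 𝔮 haC).mp ((Ideal.unit_mul_mem_iff_mem 𝔮 isUnit_one.neg).mp hD))
    · -- the `K`-chart `j = 1`: `Tᵖ + ᾱ T + ᾱγ̄`, `T = X₀ ∉ 𝔮`
      subst hj
      have h01 : (0 : Fin 2) ≠ 1 := zero_ne_one
      rw [killVar_self, killVar_of_ne 1 h01] at hmem ⊢
      refine algebraMap_notMem_maximalIdeal_sq_of_derivation_apply_notMem (pderiv ⟨0, h01⟩) 𝔮 (Localization.AtPrime 𝔮)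
        fun hD => Ideal.IsPrime.ne_top ‹_› (𝔮.eq_top_of_isUnit_mem ?_ haC)
      have hcalc : pderiv ⟨0, h01⟩ ((X ⟨0, h01⟩ : MvPolynomial {l : Fin 2 // l ≠ (1 : Fin 2)} (R ⧸ maximalIdeal R)) ^ p +
          C a * X ⟨0, h01⟩ * 1 ^ (p - 1) + C a * C g * 1 ^ p) =
            ((p : ℕ) : MvPolynomial {l : Fin 2 // l ≠ (1 : Fin 2)} (R ⧸ maximalIdeal R)) * X ⟨0, h01⟩ ^ (p - 1) + C a := by
        simp only [one_pow, mul_one, map_add, Derivation.leibniz, Derivation.leibniz_pow, pderiv_C, pderiv_X_self,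
          add_zero, smul_eq_mul, nsmul_eq_mul, mul_zero, mul_one]
      rw [hcalc, hpA, zero_mul, zero_add] at hD
      exact hD
  · -- the degenerate case `α ∈ 𝔪`: `ᾱ = 0 = ᾱγ̄`
    have ha0 : a = 0 := by
      rw [← ha]; exact Ideal.Quotient.eq_zero_iff_mem.mpr ((mem_maximalIdeal _).mpr (mem_nonunits_iff.mpr hα))
    simp only [ha0, C_0, zero_mul, add_zero]
    refine algebraMap_notMem_maximalIdeal_sq_of_notMem 𝔮 (Localization.AtPrime 𝔮) fun hmem => ?_
    rcases Fin.exists_fin_two.mp ⟨j, rfl⟩ with hj | hj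
    · subst hj
      rw [killVar_self, one_pow] at hmem
      exact Ideal.IsPrime.ne_top ‹_› ((Ideal.eq_top_iff_one 𝔮).mpr hmem)
    · subst hj
      have h01 : (0 : Fin 2) ≠ 1 := zero_ne_one
      rw [killVar_of_ne 1 h01] at hmem
      exact h𝔮 ⟨0, h01⟩ (Set.mem_singleton _) (Ideal.IsPrime.mem_of_pow_mem ‹_› _ hmem)

end Form

/-! ### §Fibre — the fibre form of an Artin–Schreier stalk at a point of the face -/

section Fibre

variable {X X' : Scheme.{0}} [IsLocallyNoetherian X] {π : X' ⟶ X} {H K : X.IdealSheafData}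
  {E L : List (X.IdealSheafData × ℕ)} {p : ℕ} {M : MarkedIdeal X}

omit [IsLocallyNoetherian X] in
open Classical in
/-- splitting the `K`-factors off a labelled product: `∏ g = t^{expOf E K} · ∏_{q.1 ≠ K} g`. [folklore] -/
theorem prod_map_eq_pow_expOf_mul {R : Type*} [CommRing R] (E : List (X.IdealSheafData × ℕ)) (K : X.IdealSheafData)
    (g : X.IdealSheafData × ℕ → R) (t : R) (hg : ∀ q ∈ E, q.1 = K → g q = t ^ q.2) :
    (E.map g).prod = t ^ expOf E K * (E.map fun q => if q.1 = K then 1 else g q).prod := by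
  classical
  induction E with
  | nil => simp
  | cons q E ih =>
    rw [List.map_cons, List.prod_cons, List.map_cons, List.prod_cons, expOf_cons,
      ih fun q' hq' => hg q' (List.mem_cons_of_mem _ hq')]
    by_cases hqK : q.1 = K
    · rw [if_pos hqK, if_pos hqK, hg q List.mem_cons_self hqK, pow_add]
      simp only [one_mul]
      ring
    · rw [if_neg hqK, if_neg hqK, zero_add]
      ring

omit [IsLocallyNoetherian X] in
/-- **FIBRE DATA at a point of the latent face** `C = V(H) ∩ V(K)` (`H ≠ K`, `expOf L K ≥ 1`): centre parameters `c` (an rsop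
pair spanning `C_y`, `H_y = (c 0)`) and `α, γ ∈ 𝒪_y` with `F(c) ∈ 𝓘_y` for the fibre form `F = X₀ᵖ + αX₀X₁^{p−1} + αγX₁ᵖ`
(`F(c) = wᵖ·(hᵖ + v(h − c m_μ) m_b m_μ^{p−1})`, `h w = c₀`, the monomials split along `z_K = c₁`). [new]
[cite: CossartPiltant2008, proof of Prop. 4.2 (a)] [cite: Kollar2007, (3.111) Step 3] -/
theorem ncHypShapeLat.exists_fibre_data (hEs : HasSNC (H :: boundaryOf E)) (hK : K ∈ boundaryOf E) (hHK : H ≠ K)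
    (hLK : 1 ≤ expOf L K) (hP : ncHypShapeLat p X E L H M) {y : X} (hy : y ∈ (((pairFace H K).sup id).support : Set X)) :
    ∃ (c : Fin 2 → X.presheaf.stalk y) (α γ : X.presheaf.stalk y), IsRsopPart c ∧
      Ideal.span (Set.range c) = stalkIdeal ((pairFace H K).sup id) y ∧ stalkIdeal H y = Ideal.span {c 0} ∧
      MvPolynomial.eval c (latentForm p α (α * γ)) ∈ stalkIdeal M.ideal y := by
  classical
  haveI : IsRegularLocalRing (X.presheaf.stalk y) := (hEs y).1
  haveI : IsDomain (X.presheaf.stalk y) := isDomain_of_isRegularLocalRing _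
  have hyT : ∀ K' ∈ pairFace H K, y ∈ K'.support := (mem_support_finsetSup_iff _ y).mp hy
  have hyH : y ∈ H.support := hyT H left_mem_pairFace
  have hyK : y ∈ K.support := hyT K right_mem_pairFace
  have hKEs : K ∈ H :: boundaryOf E := List.mem_cons_of_mem _ hK
  obtain ⟨d, z, lab, hz, hlab, hinj⟩ := exists_isRsopPart_lab hEs List.mem_cons_self hyH
  have hlabne : lab H ≠ lab K := fun h => hHK (hinj H List.mem_cons_self K hKEs hyH hyK h)
  obtain ⟨e, he0, he1⟩ : ∃ e : Fin 2 → Fin d, e 0 = lab H ∧ e 1 = lab K := ⟨![lab H, lab K], rfl, rfl⟩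
  have he : Function.Injective e :=
    Fin.forall_fin_two.mpr ⟨Fin.forall_fin_two.mpr ⟨fun _ => rfl, fun h => absurd (he0.symm.trans (h.trans he1)) hlabne⟩,
      Fin.forall_fin_two.mpr ⟨fun h => absurd (he0.symm.trans (h.symm.trans he1)) hlabne, fun _ => rfl⟩⟩
  have hc0 : (z ∘ e) 0 = z (lab H) := by rw [Function.comp_apply, he0]
  have hc1 : (z ∘ e) 1 = z (lab K) := by rw [Function.comp_apply, he1]
  have hH0 : stalkIdeal H y = Ideal.span {(z ∘ e) 0} := by rw [hc0]; exact hlab H List.mem_cons_self hyH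
  have hK0 : stalkIdeal K y = Ideal.span {(z ∘ e) 1} := by rw [hc1]; exact hlab K hKEs hyK
  have hspan : Ideal.span (Set.range (z ∘ e)) = stalkIdeal ((pairFace H K).sup id) y := by
    rw [latRange_fin_two, stalkIdeal_finsetSup _ y, pairFace_eq_insert]
    simp only [Finset.sup_insert, Finset.sup_singleton]
    rw [hH0, hK0, Ideal.span_insert]
  -- the generators and the labelled products
  obtain ⟨h, mb, mμ, cc, v, -, -, hHx, hbx, hμx, hIx⟩ := hP.exists_generator hyH
  obtain ⟨w, hw⟩ := Ideal.span_singleton_eq_span_singleton.mp (hHx.symm.trans hH0)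
  have hE : ∀ q ∈ E, q.1 ∈ H :: boundaryOf E := fun q hq => List.mem_cons_of_mem _ (fst_mem_boundaryOf hq)
  have hL : ∀ q ∈ L, q.1 ∈ H :: boundaryOf E := fun q hq =>
    List.mem_cons_of_mem _ (hP.boundaryOf_eq ▸ fst_mem_boundaryOf hq)
  have hg : ∀ F : List (X.IdealSheafData × ℕ), ∀ q ∈ F, q.1 = K →
      (fun q : X.IdealSheafData × ℕ => if y ∈ q.1.support then z (lab q.1) ^ q.2 else 1) q = (z ∘ e) 1 ^ q.2 := by
    intro F q _ hqK
    simp only [Function.comp_apply, hqK, if_pos hyK, he1]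
  obtain ⟨wb, hwb⟩ := Ideal.span_singleton_eq_span_singleton.mp
    (hbx.symm.trans (stalkIdeal_monomialIdeal_eq_span_prod hlab E hE))
  obtain ⟨wμ, hwμ⟩ := Ideal.span_singleton_eq_span_singleton.mp
    (hμx.symm.trans (stalkIdeal_monomialIdeal_eq_span_prod hlab L hL))
  rw [prod_map_eq_pow_expOf_mul E K _ ((z ∘ e) 1) (hg E)] at hwb
  rw [prod_map_eq_pow_expOf_mul L K _ ((z ∘ e) 1) (hg L)] at hwμ
  -- normal forms: `h = c₀ w⁻¹`, `m_b = c₁^{b_K}·P_E·w_b⁻¹`, `m_μ = c₁·c₁^{m}·P_L·w_μ⁻¹` (`expOf L K = m + 1`)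
  set PE := (E.map fun q => if q.1 = K then 1 else
    (fun q : X.IdealSheafData × ℕ => if y ∈ q.1.support then z (lab q.1) ^ q.2 else 1) q).prod with hPE
  set PL := (L.map fun q => if q.1 = K then 1 else
    (fun q : X.IdealSheafData × ℕ => if y ∈ q.1.support then z (lab q.1) ^ q.2 else 1) q).prod with hPL
  obtain ⟨m, hm⟩ : ∃ m, expOf L K = m + 1 := ⟨expOf L K - 1, by omega⟩
  obtain ⟨q, rfl⟩ : ∃ q, p = q + 1 := ⟨p - 1, by have := hP.prime.one_lt; omega⟩
  have hmb : mb = (z ∘ e) 1 ^ expOf E K * PE * ↑wb⁻¹ := by rw [← hwb, Units.mul_inv_cancel_right]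
  have hmμ : mμ = (z ∘ e) 1 * (z ∘ e) 1 ^ m * PL * ↑wμ⁻¹ := by
    rw [← pow_succ', ← hm, ← hwμ, Units.mul_inv_cancel_right]
  refine ⟨z ∘ e, ↑w ^ q * v * ↑wb⁻¹ * ↑wμ⁻¹ ^ q * PE * PL ^ q * (z ∘ e) 1 ^ expOf E K * ((z ∘ e) 1 ^ m) ^ q,
    -(↑w * cc * ↑wμ⁻¹ * PL * (z ∘ e) 1 ^ m), hz.comp e he, hspan, hH0, ?_⟩
  have hkey : MvPolynomial.eval (z ∘ e) (latentForm (q + 1)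
      (↑w ^ q * v * ↑wb⁻¹ * ↑wμ⁻¹ ^ q * PE * PL ^ q * (z ∘ e) 1 ^ expOf E K * ((z ∘ e) 1 ^ m) ^ q)
      (↑w ^ q * v * ↑wb⁻¹ * ↑wμ⁻¹ ^ q * PE * PL ^ q * (z ∘ e) 1 ^ expOf E K * ((z ∘ e) 1 ^ m) ^ q *
        -(↑w * cc * ↑wμ⁻¹ * PL * (z ∘ e) 1 ^ m))) =
      ↑w ^ (q + 1) * (h ^ (q + 1) + v * (h - cc * mμ) * mb * mμ ^ (q + 1 - 1)) := by
    simp only [latentForm, map_add, map_mul, map_pow, MvPolynomial.eval_X, MvPolynomial.eval_C, Nat.add_sub_cancel]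
    rw [hmb, hmμ, ← hw]
    ring
  rw [hkey, hIx]
  exact Ideal.mul_mem_left _ _ (Ideal.mem_span_singleton_self _)

/-- **`𝓘'_{x'} ⊄ 𝔪²` OVER THE CENTRE OFF `V(H')`** after the latent hop: T10c fed with the fibre form and the Artin–Schreier chart
guard. [new] [cite: CossartPiltant2008, Prop. 4.2 (a)] [cite: Kollar2007, (3.111) Step 3] -/
theorem ncHypShapeLat.not_stalkIdeal_transform_le_sq (hEs : HasSNC (H :: boundaryOf E)) (hK : K ∈ boundaryOf E) (hHK : H ≠ K)
    (hπ : IsBlowup π ((pairFace H K).sup id)) (hLK : 1 ≤ expOf L K) (hP : ncHypShapeLat p X E L H M) {x' : X'}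
    (hxC : π x' ∈ (((pairFace H K).sup id).support : Set X))
    (hx' : x' ∉ (strictTransformIdeal π ((pairFace H K).sup id) H).support) :
    ¬ stalkIdeal (M.transform π ((pairFace H K).sup id)).ideal x' ≤ maximalIdeal (X'.presheaf.stalk x') ^ 2 := by
  classical
  haveI : IsProper π := hπ.isProper
  haveI : IsLocallyNoetherian X' := LocallyOfFiniteType.isLocallyNoetherian π
  obtain ⟨c, α, γ, hc, hcspan, hHc, hFJ⟩ := hP.exists_fibre_data hEs hK hHK hLK hxC
  rw [MarkedIdeal.transform_ideal, hP.mult_eq]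
  refine IsBlowup.not_stalkIdeal_controlledTransform_le_pow_of_fibre hπ c hcspan (IsRsopPart.isQuasiRegular' hc)
    (IsRsopPart.mem_maximalIdeal hc) (isHomogeneous_latentForm hP.prime.one_lt.le α (α * γ)) hFJ 2 {0} (fun l hl => ?_)
    fun j 𝔮 _ h𝔮 => latentForm_notMem_sq hP.prime.two_le (hP.cast_eq_zero (π x')) α γ j 𝔮 h𝔮
  rw [Set.mem_singleton_iff.mp hl]
  exact map_stalkIdeal_finsetSup_eq_span_of_not_mem hEs (pair_subset_frame hK) left_mem_pairFace hπ hx' hHc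

/-- **THE GUARD `supp M' ⊆ V(H')` of the latent hop** (off the centre: local isomorphism and `supp M ⊆ V(H)` lifts; over the
centre: the Artin–Schreier guard). [new] [cite: CossartPiltant2008, Prop. 4.2 (a)] -/
theorem ncHypShapeLat.support_transform_subset (hEs : HasSNC (H :: boundaryOf E)) (hK : K ∈ boundaryOf E) (hHK : H ≠ K)
    (hπ : IsBlowup π ((pairFace H K).sup id)) (hLK : 1 ≤ expOf L K) (hP : ncHypShapeLat p X E L H M) :
    (M.transform π ((pairFace H K).sup id)).support ⊆
      ((strictTransformIdeal π ((pairFace H K).sup id) H).support : Set X') := by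
  haveI : IsProper π := hπ.isProper
  haveI : IsLocallyNoetherian X' := LocallyOfFiniteType.isLocallyNoetherian π
  intro x' hx'
  have hx'' : x' ∈ (M.transform π ((pairFace H K).sup id)).support := hx'
  by_cases hxC : π x' ∈ (((pairFace H K).sup id).support : Set X)
  · by_contra hxH
    refine hP.not_stalkIdeal_transform_le_sq hEs hK hHK hπ hLK hxC hxH ?_
    have h := (MarkedIdeal.mem_support_iff _ _).mp hx''
    rw [MarkedIdeal.transform_mult, hP.mult_eq] at h
    exact h.trans (Ideal.pow_le_pow_right hP.prime.two_le)
  · exact mem_support_strictTransformIdeal_of_not_mem hxC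
      (hP.support_subset ((hπ.mem_support_transform_iff_of_not_mem M hxC).mp hx''))

/-- ★ **THE LATENT ROUND LEMMA**: the Artin–Schreier shape survives the blow-up of the latent face `{H, K}` (`H ≠ K ∈ ∂E`,
`expOf L K ≥ 1`) — terminal labels at marking `0`, latent labels at marking `1` — for every residue field. [new]
[cite: CossartPiltant2008, Prop. 4.2 (a)] [cite: Kollar2007, (3.111) Step 3] -/
theorem ncHypShapeLat.transform (hEs : HasSNC (H :: boundaryOf E)) (hK : K ∈ boundaryOf E) (hHK : H ≠ K)
    (hπ : IsBlowup π ((pairFace H K).sup id)) (hLK : 1 ≤ expOf L K) (hP : ncHypShapeLat p X E L H M) :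
    ncHypShapeLat p X' (transformExp E π (pairFace H K) 0) (transformExp L π (pairFace H K) 1)
      (strictTransformIdeal π ((pairFace H K).sup id) H) (M.transform π ((pairFace H K).sup id)) :=
  hP.transform_of_support_subset hEs hK hHK hπ hLK (hP.support_transform_subset hEs hK hHK hπ hLK)

end Fibre

/-! ### §Mass — the latent mass drops under the hop -/

section Mass

variable {X X' : Scheme.{0}} [IsLocallyNoetherian X] {π : X' ⟶ X} {H K : X.IdealSheafData}
  {E L : List (X.IdealSheafData × ℕ)} {p : ℕ} {M : MarkedIdeal X}

omit [IsLocallyNoetherian X] in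
open Classical in
/-- the `K`-labels of `L` sum to `expOf L K`. [folklore] -/
theorem sum_map_ite_eq_expOf (L : List (X.IdealSheafData × ℕ)) (K : X.IdealSheafData) :
    (L.map fun q => if q.1 = K then q.2 else 0).sum = expOf L K := by
  induction L with
  | nil => simp
  | cons q L ih => rw [List.map_cons, List.sum_cons, expOf_cons, ih]

open Classical in
/-- ★ **THE LATENT MASS DROPS under the hop at `{H, K}`** (`expOf L K ≥ 1`, `V(K) ∩ V(H) ≠ ∅`): the strict transform of `K`
no longer meets `V(H')` (its whole label leaves the mass), every other strict transform meets `V(H')` only if its image met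
`V(H)`, and the new exceptional member carries `expOf L K − 1`. [new] -/
theorem ncHypShapeLat.latMass_transform_lt (hEs : HasSNC (H :: boundaryOf E)) (hK : K ∈ boundaryOf E) (hHK : H ≠ K)
    (hπ : IsBlowup π ((pairFace H K).sup id)) (hP : ncHypShapeLat p X E L H M) (hLK : 1 ≤ expOf L K)
    (hne : ((K.support : Set X) ∩ H.support).Nonempty) :
    latMass (transformExp L π (pairFace H K) 1) (strictTransformIdeal π ((pairFace H K).sup id) H) < latMass L H := by
  haveI : IsProper π := hπ.isProper
  haveI : IsLocallyNoetherian X' := LocallyOfFiniteType.isLocallyNoetherian π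
  obtain ⟨y₀, hy₀K, hy₀H⟩ := hne
  have hw : weightOf L (pairFace H K) = expOf L K := by rw [weightOf_pairFace hHK, hP.expOfL_eq_zero hy₀H, zero_add]
  simp only [latMass, transformExp, List.map_append, List.map_map, List.sum_append, List.map_cons, List.map_nil, List.sum_cons,
    List.sum_nil, add_zero]
  -- (1) on `L`: `f'(strict q) + [q.1 = K]·q.2 ≤ g q`, summed
  have h1 : (L.map ((fun q : X'.IdealSheafData × ℕ => if ((q.1.support : Set X') ∩
      (strictTransformIdeal π ((pairFace H K).sup id) H).support).Nonempty then q.2 else 0) ∘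
        fun q : X.IdealSheafData × ℕ => (strictTransformIdeal π ((pairFace H K).sup id) q.1, q.2))).sum + expOf L K ≤
      (L.map fun q => if ((q.1.support : Set X) ∩ H.support).Nonempty then q.2 else 0).sum := by
    rw [← sum_map_ite_eq_expOf L K, ← List.sum_map_add]
    refine List.sum_le_sum fun q hq => ?_
    simp only [Function.comp_apply]
    by_cases hqK : q.1 = K
    · -- the strict transform of `K` misses `V(H')`; `V(K)` meets `V(H)` at `y₀`
      have hemp : ¬ (((strictTransformIdeal π ((pairFace H K).sup id) q.1).support : Set X') ∩
          (strictTransformIdeal π ((pairFace H K).sup id) H).support).Nonempty := by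
        rintro ⟨x', hxK, hxH⟩
        rw [hqK] at hxK
        exact not_mem_support_strict_pair hEs hK hπ hxH hxK
      have hyes : ((q.1.support : Set X) ∩ H.support).Nonempty := ⟨y₀, by rw [hqK]; exact hy₀K, hy₀H⟩
      rw [if_neg hemp, if_pos hqK, if_pos hyes, zero_add]
    · rw [if_neg hqK, add_zero]
      by_cases hN : (((strictTransformIdeal π ((pairFace H K).sup id) q.1).support : Set X') ∩
          (strictTransformIdeal π ((pairFace H K).sup id) H).support).Nonempty
      · obtain ⟨x', hxq, hxH⟩ := hN
        rw [if_pos ⟨x', hxq, hxH⟩, if_pos ⟨π x', mem_support_of_mem_support_strictTransformIdeal hxq,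
          mem_support_of_mem_support_strictTransformIdeal hxH⟩]
      · rw [if_neg hN]
        exact Nat.zero_le _
  -- (2) the exceptional member carries at most `weightOf L {H,K} − 1 = expOf L K − 1`
  split_ifs <;> omega

end Mass

end Summit.ResolutionOfSingularities.ResolutionOfSingularities.Theorems.DeltaCutClasses

end
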